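import Summits.BirchSwinnertonDyer.BirchSwinnertonDyer.Theorems.UniversalToricDescentTwinDecLocusTateCube
import Summits.BirchSwinnertonDyer.BirchSwinnertonDyer.Theorems.UniversalToricDescentTowerNoPTorsionTwin
import HarnessLib

/-!
# Route `UniversalToricDescent`, cruxes ♭B `TwinWanFrameAtThreeMult` (stmt-BirchSwinnertonDyer-26062) / `TwinSplitIMCAtThreeMult`
# (stmt-BirchSwinnertonDyer-20694), lines `membertower` v4 / `threeframes` v7, research stub `stub_wanFrameMultCube` (the CUBE
# LOCUS): whether a 3-congruent multiplicative twin `W′` of the cell curve `E` lies on the cube locus is a property of `E` ALONE —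
# it does iff `E(ℚ₃)[3] ≠ 0` (the census condition (iv) of ♭T/♭T′) — so on the cell curves with `E(ℚ₃)[3] = 0` NO twin is on the
# cube locus, and there the member tower is ♭B's only research atom left after act F

Cell `bsd-wall` (run/shared/lean/pub/bsd-wall/), width seat `bsd-wall-utd-p2-w2` (prover g3, 2026-08-28);
`--supports stmt-BirchSwinnertonDyer-20694 --as helper`; Theses-free.

## Context (numbers, not adjectives)

After LEAD g11's port and act F (this seat: torsion of `X^∅_ac(W′)` is supplied by kernel″'s own data), the deciding twin crux
♭B carries two research stubs on its line `membertower`: the rational `m`-uniform member tower and `stub_wanFrameMultCube` — ♭B's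
consequent on twins `W′` SPLIT multiplicative at 3 with Tate parameter `q ∈ (ℚ₃ˣ)³`, the exact locus where the descent's local
binder (dec) `W′(ℚ₃)[3] = 0` fails (`twin_dec_or_cube`, `twin_not_dec_of_cube`, p612881). The kernel does not choose `W′`: it is
handed a 3-congruent twin of the cell curve `E` (`O6.ModPCongruent W′ E 3`). utd-p1 g5's tree theorem
`UniversalToricDescentTowerTorsion.baseChange_noThreeTorsion_iff_of_modPCongruent` (elementary Galois descent along
`E[3] ≃ W′[3]`) says `E(F)[3] = 0 ↔ W′(F)[3] = 0` for every characteristic-0 field `F`, in particular `F = ℚ₃`. Hence: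

* §1 `twin_dec_iff_cell_dec` — (dec) for the twin ⟺ (iv) `E(ℚ₃)[3] = 0` for the cell curve;
  `twin_cube_iff_cell_threeTorsion` — a multiplicative twin has a Tate datum with cube `q` ⟺ `E(ℚ₃)[3] ≠ 0`;
  `twin_dec_of_cell_dec` / `twin_not_cube_of_cell_dec` — on a cell curve with `E(ℚ₃)[3] = 0` EVERY 3-congruent multiplicative
  twin satisfies (dec) and NONE is on the cube locus; `cell_threeTorsion_of_twin_cube` — a cube twin forces `E(ℚ₃)[3] ≠ 0`.
* §2 `twin_wanClauseTD_iff` — bookkeeping for the pen: for a twin of a (iv)-good cell curve, a Wan clause owed «under torsion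
  of `X^∅_ac(W′)` AND (dec)» is the same as one owed «under torsion» (act F's ♭B_T consequent), since (dec) holds outright.

PLANNER DATUM (act G, with act F): split the twin leaf by (iv). On cell curves with `E(ℚ₃)[3] = 0` the kernel can hand the
line BOTH binders — torsion of `X^∅_ac(W′)` (act F) and (dec) for `W′` (this file) — so ♭B re-typed as «∃ frame `L′` ∧
(torsion → (dec) → ∃ k, `3^k·Ch(W′)·R₀⟦T⟧ ⊆ (L′)`)» closes from `stub_memberTowerMult` ALONE (line `membertower_TD`, crux workfile);
on cell curves with `E(ℚ₃)[3] ≠ 0` every multiplicative twin is a cube twin and `stub_wanFrameMultCube` is the whole of ♭B's Wan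
side. The size of the two parts is the census count of (iv) on bucket B (utd-p1 g11: (iv) fails on 206 split-type classes
route-wide). HONEST FRAMING: theorems only (no definition, no named fact, no `sorry`); unconditional; closes nothing; BSD is not
proved by any of this.

References: [Serre1972] §4; [SilvermanATAEC1994] Thm. V.3.1 (d), Thm. V.5.3; [SilvermanAEC2009] III.§7.
-/

noncomputable section

open scoped Classical

set_option linter.dupNamespace false
set_option autoImplicit false

namespace Summit.BirchSwinnertonDyer.BirchSwinnertonDyer.Theorems.UniversalToricDescentTwinCubeLocusOfCell

open WeierstrassCurve Literature.NumberTheory.EllipticCurves Literature.NumberTheory.EllipticCurves.Rank1Residual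
  Summit.BirchSwinnertonDyer.Rank1Residual.O6
  Summit.BirchSwinnertonDyer.BirchSwinnertonDyer.Theorems.UniversalToricDescentTowerTorsion
  Summit.BirchSwinnertonDyer.BirchSwinnertonDyer.Theorems.UniversalToricDescentTwinDecLocus

/-! ### §1 The cube locus of the twin is decided by the cell curve -/

section Dichotomy

variable (W : WeierstrassCurve ℚ) [W.IsElliptic] (W' : WeierstrassCurve ℚ) [W'.IsElliptic] [W'.IsGloballyMinimal]

omit [W'.IsGloballyMinimal] in
/-- **(dec) for a 3-congruent twin ⟺ (iv) for the cell curve**: `W′(ℚ₃)[3] = 0 ↔ E(ℚ₃)[3] = 0` along `W′[3] ≃ E[3]`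
(`baseChange_noThreeTorsion_iff_of_modPCongruent` at `F = ℚ₃`). [cite: Serre1972, §4] -/
theorem twin_dec_iff_cell_dec (hcong : ModPCongruent W' W 3) :
    (∀ Q : (W'.baseChange ℚ_[3]).toAffine.Point, 3 • Q = 0 → Q = 0) ↔
      ∀ Q : (W.baseChange ℚ_[3]).toAffine.Point, 3 • Q = 0 → Q = 0 :=
  (baseChange_noThreeTorsion_iff_of_modPCongruent W W' ℚ_[3] hcong).symm

omit [W'.IsGloballyMinimal] in
/-- **On a cell curve with `E(ℚ₃)[3] = 0`, every 3-congruent twin satisfies (dec).** [cite: Serre1972, §4] -/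
theorem twin_dec_of_cell_dec (hcong : ModPCongruent W' W 3)
    (hiv : ∀ Q : (W.baseChange ℚ_[3]).toAffine.Point, 3 • Q = 0 → Q = 0) :
    ∀ Q : (W'.baseChange ℚ_[3]).toAffine.Point, 3 • Q = 0 → Q = 0 :=
  (twin_dec_iff_cell_dec W W' hcong).mpr hiv

/-- **A multiplicative twin is on the CUBE LOCUS iff the cell curve has a `ℚ₃`-rational point of order 3**: for `W′`
multiplicative at 3 and 3-congruent to `E`, `(∃ D : TateParameterData W′ 3, ∃ u, u³ = D.q) ↔ ¬ (E(ℚ₃)[3] = 0)` — by the exact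
dichotomy `twin_dec_or_cube` / `twin_not_dec_of_cube` (p612881) and §1. So the cube locus is a property of the CLASS, not of the
chosen twin. [cite: SilvermanATAEC1994, Thm. V.3.1 (d) and Thm. V.5.3] [cite: Serre1972, §4] -/
theorem twin_cube_iff_cell_threeTorsion (hcong : ModPCongruent W' W 3) (hmult : Mult W' 3) :
    (∃ (D : TateParameterData W' 3) (u : ℚ_[3]), u ^ 3 = D.q) ↔
      ¬ ∀ Q : (W.baseChange ℚ_[3]).toAffine.Point, 3 • Q = 0 → Q = 0 := by
  constructor
  · rintro ⟨D, u, hu⟩ hiv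
    exact twin_not_dec_of_cube W' D ⟨u, hu⟩ (twin_dec_of_cell_dec W W' hcong hiv)
  · intro h
    rcases twin_dec_or_cube W' hmult with hdec | hcube
    · exact absurd ((twin_dec_iff_cell_dec W W' hcong).mp hdec) h
    · exact hcube

omit [W'.IsGloballyMinimal] in
/-- **On a cell curve with `E(ℚ₃)[3] = 0`, NO 3-congruent multiplicative twin is on the cube locus** (the research stub
`stub_wanFrameMultCube` of line `membertower` is never invoked for such a class). [cite: SilvermanATAEC1994, Thm. V.3.1 (d) and Thm. V.5.3] -/
theorem twin_not_cube_of_cell_dec (hcong : ModPCongruent W' W 3)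
    (hiv : ∀ Q : (W.baseChange ℚ_[3]).toAffine.Point, 3 • Q = 0 → Q = 0)
    (D : TateParameterData W' 3) : ¬ ∃ u : ℚ_[3], u ^ 3 = D.q :=
  fun hu ↦ twin_not_dec_of_cube W' D hu (twin_dec_of_cell_dec W W' hcong hiv)

omit [W'.IsGloballyMinimal] in
/-- **A cube twin forces `E(ℚ₃)[3] ≠ 0` on the cell curve** (contrapositive reading, for the census: the classes where the cube
stub bites are exactly the (iv)-bad classes of ♭T/♭T′). [cite: SilvermanATAEC1994, Thm. V.3.1 (d) and Thm. V.5.3] -/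
theorem cell_threeTorsion_of_twin_cube (hcong : ModPCongruent W' W 3) (D : TateParameterData W' 3) {u : ℚ_[3]}
    (hu : u ^ 3 = D.q) : ∃ Q : (W.baseChange ℚ_[3]).toAffine.Point, 3 • Q = 0 ∧ Q ≠ 0 := by
  by_contra h
  push Not at h
  exact twin_not_cube_of_cell_dec W W' hcong (fun Q hQ ↦ h Q hQ) D ⟨u, hu⟩

/-- The same dichotomy read on the twin alone: a multiplicative `W′` is on the cube locus iff `W′(ℚ₃)[3] ≠ 0`.
[cite: SilvermanATAEC1994, Thm. V.3.1 (d) and Thm. V.5.3] -/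
theorem twin_cube_iff_not_dec (hmult : Mult W' 3) :
    (∃ (D : TateParameterData W' 3) (u : ℚ_[3]), u ^ 3 = D.q) ↔
      ¬ ∀ Q : (W'.baseChange ℚ_[3]).toAffine.Point, 3 • Q = 0 → Q = 0 := by
  constructor
  · rintro ⟨D, u, hu⟩ hdec
    exact twin_not_dec_of_cube W' D ⟨u, hu⟩ hdec
  · intro h
    rcases twin_dec_or_cube W' hmult with hdec | hcube
    · exact absurd hdec h
    · exact hcube

end Dichotomy

/-! ### §2 Bookkeeping for the pen: the doubly-conditional Wan clause on a (iv)-good class -/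

section Clause

variable (W : WeierstrassCurve ℚ) [W.IsElliptic] (W' : WeierstrassCurve ℚ) [W'.IsElliptic]

/-- For a 3-congruent twin of a cell curve with `E(ℚ₃)[3] = 0`, a clause `C` owed «under (dec) for `W′`» is owed outright, and one
owed «under `T` and (dec)» is the same as one owed «under `T`» — the shape in which the kernel feeds act F's torsion binder and
act G's (dec) binder to a re-typed ♭B. Pure logic over §1. [folklore] -/
theorem twin_clause_of_dec_imp (hcong : ModPCongruent W' W 3)
    (hiv : ∀ Q : (W.baseChange ℚ_[3]).toAffine.Point, 3 • Q = 0 → Q = 0) {T C : Prop}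
    (h : T → (∀ Q : (W'.baseChange ℚ_[3]).toAffine.Point, 3 • Q = 0 → Q = 0) → C) : T → C :=
  fun hT ↦ h hT (twin_dec_of_cell_dec W W' hcong hiv)

end Clause

end Summit.BirchSwinnertonDyer.BirchSwinnertonDyer.Theorems.UniversalToricDescentTwinCubeLocusOfCell

end
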